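import Literature.NumberTheory.Automorphic.FLSModularCurveSplitThreeSplitFive
import Summits.Langlands.Langlands.Theorems.SqrtFiveQuarticCoversCertificates

/-!
# Route `Langlands/SqrtFiveQuarticCovers`, crux `RefinedLocusModular` — certificate `CertS3H8`
# (= hypothesis `hC` of `refinedLocusModular_of_certificates`; sheets 4.4 `X(s3,H8,b7)` g109 and
# 4.8 `X(s3,H8,e7)` g593 of cell `pub/lg-quartmod`, rung F-L1) FROM one printed fact and ONE
# certified finite computation, with the glue kernel-checked

`CertS3H8` (lead SHEET-WORDS v0, 2026-08-28T20:32Z, sha16 f936f54e5f68f23a): «for every totally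
real quartic number field `K` with `√5 ∈ K` and every elliptic curve `E/K` given by an integral
Weierstrass model with `Δ ≠ 0`, framings of `E[ℓ]` as in the crux: if `ρ̄_{E,3}` has image in
`C_s⁺(3) = ⟨diag(1,2), antidiag(1,1)⟩` in some framing and `ρ̄_{E,5}` has image in
`H8 = ⟨diag(2,3), antidiag(1,1)⟩` in some framing (mod-`7` free), then `E` has CM or
`j(E) ∈ ℚ(√5)`» — `j ∈ ℚ(√5)` typed division-free as in the tree:
`∃ r, r² = 5 ∧ ∃ a b : ℚ, c₄(E_K)³ = (a + b·r)·Δ(E_K)`.  The conclusion of `certS3H8_of_facts` below is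
the route item `Summit.Langlands.Langlands.Theses.SqrtFiveQuarticCovers.CertS3H8` BY NAME
(stmt-Langlands-23415, child of the crux since the split of rev 7) — whose text is that hypothesis
`hC` of `refinedLocusModular_of_certificates` (file `SqrtFiveQuarticCoversCertificates.lean`,
p653708) VERBATIM, so the theorem also fills the `hC` slot by `exact` (done below).

## The two inputs, and what is kernel-checked

* PRINT (named Literature fact `FLS2015.s3s5_jRelation_of_isTorsionGaloisRep`, file
  `Literature/NumberTheory/Automorphic/FLSModularCurveSplitThreeSplitFive.lean`): Freitas–Le
  Hung–Siksek 2015 §2.2 (moduli interpretation of `X(H₁,…,H_r)`) + §5.3 (canonical model of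
  `X(s3,s5) ≅ X₀(225)/⟨w₉,w₂₅⟩` in `ℙ³` and its `j`-map (js3s5)): an `E/K` with
  split-Cartan-normaliser level structure at `3` and `5` gives a point `x ≠ 0` of the printed model
  with `c₄³·JDen(x) = JNum(x)·Δ`, completed at the fourteen zeros of `JDen` by the values
  `j ∈ {−2¹⁵, 66³}` of the printed map at its non-cuspidal members.
* COMPUTATION (hypothesis `hE9`, WRITTEN OUT — D-0027 §2.1: no vendored `Prop` under `Summits/`,
  and a computation is not Literature; its registered name on the ledger is the item this file
  closes conditionally), «CERT-E9′»: **on the printed model of `X(s3,s5)`, at every point defined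
  over a totally real quartic field `K ∋ √5`, the printed `j`-denominator vanishes or the printed
  `j`-value lies in `ℚ(√5)`.**  This is the coarse theorem E9′ of the cell (FLS's proof of their
  Lemma run over `k = ℚ(√5)` instead of `ℚ`): «let `K ⊇ k`, `[K:k] ≤ 2`, `P ∈ X(s3,s5)(K)`
  non-cuspidal; then `j(P) ∈ k`, or `j(P) = 1728` with `K ∈ {k(√−3), k(√−15)}` (not totally
  real)» — carrier `X(s3,s5) = X(s3,H8)/ι` of genus `4` over `ℚ`, image of the sheets' carrier
  `X(s3,H8) = (X₀(225)/w₉)^ε` of genus `9` over `k`; finite data: `D₁(k) = 15A8(k) = ℤ/8`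
  (`8` points), `J(D₃)(k) ≅ ℤ/40` exactly (`40` Mumford classes, `15` exceptional quadratic pairs
  of `D₃`, `14` of them with `h₁(w) ∉ K²`, the last over `w² − w + 4 = 0` giving `j = 1728` over
  `k(√−15)`), `X(s3,s5)(k) = 6` cusps `+ 6` CM points (`j = −32768`), the node `w = 0`
  (`j = 66³`, a pair over `k(√3)`), `w = 1` (`j = 1728` over `k(√−3)`), and the infinite family
  `φ₂⁻¹(D₂(k))` with `w, v ∈ k` hence `j ∈ k`.
  TWO INDEPENDENT EXACT LINEAGES: (L1) eng-9, `HOME/lg-quartmod-eng-9/evidence/e9-coarse/E9-COARSE.md`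
  sha16 75c718e0b5108ddd, README c829be806a3a1821 (Sage 10.9, kit j312611 `jobB_fls_over_k.py`
  1c1a666f31916079, stdout e50b6bb096c92351, j313249 jcheck); (L2) eng-3,
  `HOME/lg-quartmod-eng-3/E9-RESULT.md` sha16 00025806a59bf964 + REPRO.md (PARI/GP 2.17.3 kit
  j312565, j312793; Sage j313230, j313371, j313394, j313423: own model `9x₁²−3x₂²−5x₃²−x₄² = 0,
  9x₂²x₃−5x₃³+4x₄³ = 0` from the four eigenforms, `C4(k) = 12` points, `D1(k)` via `elltors`,
  `J(D3)(k) = ℤ/40` with the non-`2`-divisibility of the order-`8` class in `J(D₃)(𝔽₁₉)`, case (A)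
  «contributes nothing», and the FINE statement «all points of degree `≤ 2` over `k` on `X(s3,H8)`
  are `8` cusps `+ 2` cuspidal pairs `+ 6` CM (`j = −32768`) `+ 2` CM (`j = 1728`)»); `k`-points
  agreed on the two lineages (STATUS 16:53:54Z / 16:42Z).  CERTNUM (pub/certnum/RELEASES.md,
  independent-lineage replay + referee countersign, checker ratpcert 0.7.0): l.131 TORJ2
  «`J(D₃)(ℚ(√5))_tors ≅ ℤ/40` complete, two lineages», l.132 TORE «`15a8(k)_tors ≅ ℤ/8`,
  `15a8^δ(k)_tors ≅ ℤ/2` complete», l.133 SQC «B2 square classes of the 15 exceptional classes»,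
  l.134 C-side PT «9 `k`-points + 3 degree-2 places»; rank-0 inputs l.123 LV0 (RQ-026 (i): 16/16
  exact non-vanishings `L(f⊗χ,1)` at level `75` over `ℚ(√5)`).  NAMED INPUTS IT RESTS ON (not
  proved anywhere in the tree): rank `0` over `k` of `D₁ ≅ 15A8` and of `J(D₃) ~ 75B1 × 75C1`
  (PRINTED: FLS §5.2 p. 24 «the three curves `Eᵢ` [15A1, 75B1, 75C1] have rank `0` over `ℚ` and so
  do their quadratic twists by `5` … rank `0` over `ℚ` and over `ℚ(√5)`», 2-descent; the cell
  re-ran mwrank with `certain = True` and has the exact `L`-values + Kolyvagin–Logachev as a second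
  road); Kani–Rosen for `J(X) ~ D₁ × D₂ × J(D₃)`; Katz 1981 (injectivity of prime-to-`𝔮` torsion
  under reduction, `e < p − 1`); the model/`j`-map identification is the PRINT fact above.
  «A certified finite datum is not a modularity statement.»
* KERNEL-CHECKED: `H8 ≤ N(C_s(5))` and `⟨diag(1,2), antidiag(1,1)⟩ ≤ N(C_s(3))` in Serre's
  vocabulary (`Serre1972.splitCartan 1`), by generator membership (here); the explicit points of
  the printed model (the four rational points over `w = ∞`, the eight `ℚ(√5)`-points over
  `w² = w + 1`, the numerator `(1 + x₂)³` at `x₄ = 0`, `R₁(0) = −132`, the locus `x₃ = x₄ = 0`,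
  the zero locus of the denominator) in the Literature file, section `ModelChecks`; the written-out framings of the
  crux ARE `WeierstrassCurve.IsTorsionGaloisRep` (by `δ`); the case analysis «`JDen(x) = 0` ⇒
  `j ∈ {−2¹⁵, 66³} ⊂ ℚ ⊂ ℚ(√5)`; else cancel `JDen(x) ≠ 0` in `c₄³·JDen = (a + b r)·JDen·Δ`»;
  `8 ≠ 0` in characteristic `0`.  The CM disjunct of the certificate is never needed (every `j`
  that occurs lies in `ℚ(√5)`).

HONEST STATUS: CONDITIONAL bookkeeping + finite group theory; the certificate holds modulo
{one printed fact, one certified computation}; nothing here proves modularity of any curve, and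
the computation is NOT replayed in Lean (the tree has no carrier for modular curves, Jacobians of
genus-2 curves over number fields, or Mordell–Weil groups).  References: [FreitasLeHungSiksek2015]
§2.2, §5.2 (p. 24), §5.3 (pp. 26–27 of arXiv:1310.7088); cell records CENSUS.md §15 row 4.4/4.8,
SHEET-WORDS-v0.md §1 (CertS3H8).
-/

noncomputable section

set_option linter.dupNamespace false -- project-wide option; `Summit.Langlands.Langlands` is the mandated namespace

open scoped MatrixGroups NumberField Matrix
open NumberField Field
open Literature.NumberTheory.Automorphic Literature.NumberTheory.GaloisRepresentations
open Literature.NumberTheory.Automorphic.FLS2015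
open Summit.Langlands.Langlands.Theses.SqrtFiveQuarticCovers

namespace Summit.Langlands.Langlands.Theorems.SqrtFiveQuarticCovers

/-! ### Finite group theory: the crux's explicit subgroups sit in Serre's split-Cartan normalisers -/

/-- `H8 = ⟨diag(2,3), antidiag(1,1)⟩ ≤ GL₂(𝔽₅)` is contained in the normaliser of the standard split
Cartan subgroup `(* 0; 0 *)` (`Serre1972.splitCartan 1`): the first generator is diagonal, the
second antidiagonal. [folklore] -/
theorem closure_H8_le_normalizer_splitCartan :
    Subgroup.closure ({(⟨!![2, 0; 0, 3], !![3, 0; 0, 2], by decide, by decide⟩ : GL (Fin 2) (ZMod 5)),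
        (⟨!![0, 1; 1, 0], !![0, 1; 1, 0], by decide, by decide⟩ : GL (Fin 2) (ZMod 5))} :
        Set (GL (Fin 2) (ZMod 5))) ≤
      Subgroup.normalizer (Serre1972.splitCartan (1 : GL (Fin 2) (ZMod 5)) : Set (GL (Fin 2) (ZMod 5))) := by
  rw [Subgroup.closure_le]
  rintro g (rfl | rfl)
  · refine Subgroup.le_normalizer (Serre1972.mem_splitCartan_iff.mpr ?_)
    simp only [inv_one, one_mul, mul_one]
    exact ⟨by decide, by decide⟩
  · refine Serre1972.mem_normalizer_splitCartan_of_isAd ?_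
    simp only [inv_one, one_mul, mul_one]
    exact ⟨by decide, by decide⟩

/-- `C_s⁺(3) = ⟨diag(1,2), antidiag(1,1)⟩ ≤ GL₂(𝔽₃)` (the crux's `s3` group) is contained in the
normaliser of the standard split Cartan subgroup (`Serre1972.splitCartan 1`). [folklore] -/
theorem closure_s3_le_normalizer_splitCartan :
    Subgroup.closure ({(⟨!![1, 0; 0, 2], !![1, 0; 0, 2], by decide, by decide⟩ : GL (Fin 2) (ZMod 3)),
        (⟨!![0, 1; 1, 0], !![0, 1; 1, 0], by decide, by decide⟩ : GL (Fin 2) (ZMod 3))} :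
        Set (GL (Fin 2) (ZMod 3))) ≤
      Subgroup.normalizer (Serre1972.splitCartan (1 : GL (Fin 2) (ZMod 3)) : Set (GL (Fin 2) (ZMod 3))) := by
  rw [Subgroup.closure_le]
  rintro g (rfl | rfl)
  · refine Subgroup.le_normalizer (Serre1972.mem_splitCartan_iff.mpr ?_)
    simp only [inv_one, one_mul, mul_one]
    exact ⟨by decide, by decide⟩
  · refine Serre1972.mem_normalizer_splitCartan_of_isAd ?_
    simp only [inv_one, one_mul, mul_one]
    exact ⟨by decide, by decide⟩

/-! ### The certificate from the two inputs -/

/-- Elementary: in a field of characteristic `0`, `JDen(x₃,x₄) = 8x₄¹⁵(x₃² − x₃x₄ − x₄²)¹⁵ = 0`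
forces `x₄(x₃² − x₃x₄ − x₄²) = 0`. [folklore] -/
theorem mul_eq_zero_of_s3s5JDen_eq_zero {K : Type*} [Field K] [CharZero K] {x₃ x₄ : K}
    (h : s3s5JDen x₃ x₄ = 0) : x₄ * (x₃ ^ 2 - x₃ * x₄ - x₄ ^ 2) = 0 := by
  simp only [s3s5JDen, mul_eq_zero, pow_eq_zero_iff (Nat.succ_ne_zero 14), OfNat.ofNat_ne_zero,
    false_or] at h
  exact mul_eq_zero.mpr h

/-- **`CertS3H8` from FLS 2015 §2.2+§5.3 (named fact) and the certified computation CERT-E9′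
(written-out hypothesis `hE9`, see the module docstring for its datum, lineages eng-9
75c718e0b5108ddd / eng-3 00025806a59bf964, certnum RELEASES l.131–l.134, and named inputs).**
For `K` totally real quartic with `√5 ∈ K` and `E / 𝓞 K` (`Δ ≠ 0`) whose mod-`3` image lies in
`⟨diag(1,2), antidiag(1,1)⟩ = C_s⁺(3)` and whose mod-`5` image lies in `H8` (each in some framing
of `E[p]`, written out as in the crux), `E` has CM or `c₄³ = (a + b r)·Δ` with `r² = 5`,
`a, b ∈ ℚ`.  Proof: both subgroups lie in Serre's split-Cartan normalisers, so the named fact gives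
a point `x ≠ 0` of the printed model of `X(s3,s5)` over `K` with `c₄³·JDen(x) = JNum(x)·Δ`; by
`hE9` either `JDen(x) = 0` — then the fact's completion gives `j = 66³` or `j = −2¹⁵`, both in
`ℚ` — or `JNum(x) = (a + b r)·JDen(x)` and `JDen(x) ≠ 0` cancels.  The statement is the route item
`CertS3H8` by name (= hypothesis `hC` of `refinedLocusModular_of_certificates` verbatim).  CONDITIONAL on the two inputs; «a
certified finite datum is not a modularity statement».
[cite: FreitasLeHungSiksek2015, §2.2 and §5.3 (arXiv:1310.7088 pp. 9, 26–27)] -/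
theorem certS3H8_of_facts (hM : FLS2015.s3s5_jRelation_of_isTorsionGaloisRep)
    (hE9 : ∀ (K : Type) [Field K] [NumberField K], NumberField.IsTotallyReal K →
      Module.finrank ℚ K = 4 → ∀ r : K, r ^ 2 = 5 → ∀ x₁ x₂ x₃ x₄ : K,
        (x₁ ≠ 0 ∨ x₂ ≠ 0 ∨ x₃ ≠ 0 ∨ x₄ ≠ 0) → s3s5Quadric x₁ x₂ x₃ x₄ = 0 →
          s3s5Cubic x₁ x₂ x₃ x₄ = 0 →
            s3s5JDen x₃ x₄ = 0 ∨
              ∃ a b : ℚ, s3s5JNum x₂ x₃ x₄ = ((a : K) + (b : K) * r) * s3s5JDen x₃ x₄) :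
    CertS3H8 := by
  intro K _ _ hK hd hr5 E hΔ h3 h5
  obtain ⟨r, hr⟩ := hr5
  obtain ⟨ρ₃, hρ₃, him₃⟩ := h3
  obtain ⟨ρ₅, hρ₅, him₅⟩ := h5
  have h3' : ∃ ρ : FramedGaloisRep K (ZMod 3) 2, (E.baseChange K).IsTorsionGaloisRep 3 ρ ∧
      ∃ P : GL (Fin 2) (ZMod 3), ∀ σ : absoluteGaloisGroup K,
        ρ σ ∈ Subgroup.normalizer (Serre1972.splitCartan P : Set (GL (Fin 2) (ZMod 3))) :=
    ⟨ρ₃, hρ₃, 1, fun σ => closure_s3_le_normalizer_splitCartan (him₃ σ)⟩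
  have h5' : ∃ ρ : FramedGaloisRep K (ZMod 5) 2, (E.baseChange K).IsTorsionGaloisRep 5 ρ ∧
      ∃ P : GL (Fin 2) (ZMod 5), ∀ σ : absoluteGaloisGroup K,
        ρ σ ∈ Subgroup.normalizer (Serre1972.splitCartan P : Set (GL (Fin 2) (ZMod 5))) :=
    ⟨ρ₅, hρ₅, 1, fun σ => closure_H8_le_normalizer_splitCartan (him₅ σ)⟩
  obtain ⟨x₁, x₂, x₃, x₄, hne, hQ, hC, hj, hnode, hbad⟩ := hM K E hΔ h3' h5'
  refine Or.inr ⟨r, hr, ?_⟩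
  -- the value of `j` at a zero of the printed denominator is rational
  have hzero : s3s5JDen x₃ x₄ = 0 →
      ∃ a b : ℚ, (E.baseChange K).c₄ ^ 3 = ((a : K) + (b : K) * r) * (E.baseChange K).Δ := by
    intro hD
    by_cases h34 : x₃ = 0 ∧ x₄ = 0
    · exact ⟨287496, 0, by rw [hnode h34.1 h34.2]; push_cast; ring⟩
    · have h34' : x₃ ≠ 0 ∨ x₄ ≠ 0 := by
        by_cases hx₃ : x₃ = 0
        · exact Or.inr fun hx₄ => h34 ⟨hx₃, hx₄⟩
        · exact Or.inl hx₃
      exact ⟨-32768, 0, by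
        rw [hbad h34' (mul_eq_zero_of_s3s5JDen_eq_zero hD)]; push_cast; ring⟩
  rcases hE9 K hK hd r hr x₁ x₂ x₃ x₄ hne hQ hC with hD | ⟨a, b, hab⟩
  · exact hzero hD
  · by_cases hD : s3s5JDen x₃ x₄ = 0
    · exact hzero hD
    · refine ⟨a, b, mul_right_cancel₀ hD ?_⟩
      rw [hj, hab]
      ring

/-- **The crux `RefinedLocusModular` with the certificate `CertS3H8` DISCHARGED to its two inputs**:
the other four certificates (`hA`, `hB7`, `hD`, `hE`, written out exactly as in
`refinedLocusModular_of_certificates`), the bridge facts `FLS2015_theorem1` + soluble base change,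
the printed fact `FLS2015.s3s5_jRelation_of_isTorsionGaloisRep` and the certified computation
CERT-E9′ (`hE9`) imply the crux — `refinedLocusModular_of_certificates` with its `hC` slot filled
by `certS3H8_of_facts`.  CONDITIONAL bookkeeping; nothing here proves modularity of any curve.
[cite: FreitasLeHungSiksek2015, §2.2, §5.3 and Thm. 1] -/
theorem refinedLocusModular_of_certificates_of_certS3H8_inputs
    (hA : ∀ (K : Type) [Field K] [NumberField K], NumberField.IsTotallyReal K → Module.finrank ℚ K = 4 → (∃ r : K, r ^ 2 = 5) →
        ∀ E : WeierstrassCurve (NumberField.RingOfIntegers K), E.Δ ≠ 0 →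
          (∃ ρ : Literature.NumberTheory.GaloisRepresentations.FramedGaloisRep K (ZMod 3) 2, (∃ e : (E.baseChange K).geomTorsion ((3 : ℕ) : ℤ) ≃+ (Fin 2 → ZMod 3), ∀ (σ : Field.absoluteGaloisGroup K) (P : (E.baseChange K).geomTorsion ((3 : ℕ) : ℤ)), e (σ • P) = ((ρ σ : GL (Fin 2) (ZMod 3)) : Matrix (Fin 2) (Fin 2) (ZMod 3)) *ᵥ (e P)) ∧ ((∀ σ : Field.absoluteGaloisGroup K, (((ρ σ : GL (Fin 2) (ZMod 3)) : Matrix (Fin 2) (Fin 2) (ZMod 3)) 1 0 = 0)))) →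
          (∃ ρ : Literature.NumberTheory.GaloisRepresentations.FramedGaloisRep K (ZMod 5) 2, (∃ e : (E.baseChange K).geomTorsion ((5 : ℕ) : ℤ) ≃+ (Fin 2 → ZMod 5), ∀ (σ : Field.absoluteGaloisGroup K) (P : (E.baseChange K).geomTorsion ((5 : ℕ) : ℤ)), e (σ • P) = ((ρ σ : GL (Fin 2) (ZMod 5)) : Matrix (Fin 2) (Fin 2) (ZMod 5)) *ᵥ (e P)) ∧ ((∀ σ : Field.absoluteGaloisGroup K, (ρ σ : GL (Fin 2) (ZMod 5)) ∈ Subgroup.closure ({(⟨!![2, 0; 0, 3], !![3, 0; 0, 2], by decide, by decide⟩ : GL (Fin 2) (ZMod 5)), (⟨!![0, 1; 1, 0], !![0, 1; 1, 0], by decide, by decide⟩ : GL (Fin 2) (ZMod 5))} : Set (GL (Fin 2) (ZMod 5)))))) →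
          ((∃ ρ : Literature.NumberTheory.GaloisRepresentations.FramedGaloisRep K (ZMod 7) 2, (∃ e : (E.baseChange K).geomTorsion ((7 : ℕ) : ℤ) ≃+ (Fin 2 → ZMod 7), ∀ (σ : Field.absoluteGaloisGroup K) (P : (E.baseChange K).geomTorsion ((7 : ℕ) : ℤ)), e (σ • P) = ((ρ σ : GL (Fin 2) (ZMod 7)) : Matrix (Fin 2) (Fin 2) (ZMod 7)) *ᵥ (e P)) ∧ ((∀ σ : Field.absoluteGaloisGroup K, (((ρ σ : GL (Fin 2) (ZMod 7)) : Matrix (Fin 2) (Fin 2) (ZMod 7)) 1 0 = 0)))) ∨ (∃ ρ : Literature.NumberTheory.GaloisRepresentations.FramedGaloisRep K (ZMod 7) 2, (∃ e : (E.baseChange K).geomTorsion ((7 : ℕ) : ℤ) ≃+ (Fin 2 → ZMod 7), ∀ (σ : Field.absoluteGaloisGroup K) (P : (E.baseChange K).geomTorsion ((7 : ℕ) : ℤ)), e (σ • P) = ((ρ σ : GL (Fin 2) (ZMod 7)) : Matrix (Fin 2) (Fin 2) (ZMod 7)) *ᵥ (e P)) ∧ ((∀ σ : Field.absoluteGaloisGroup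 K, (ρ σ : GL (Fin 2) (ZMod 7)) ∈ Subgroup.closure ({(⟨!![0, 5; 3, 0], !![0, 5; 3, 0], by decide, by decide⟩ : GL (Fin 2) (ZMod 7)), (⟨!![5, 0; 3, 2], !![3, 0; 6, 4], by decide, by decide⟩ : GL (Fin 2) (ZMod 7))} : Set (GL (Fin 2) (ZMod 7))))))) →
          ((E.baseChange K).HasCM ∨ (∃ r : K, r ^ 2 = 5 ∧ ∃ a b : ℚ, (E.baseChange K).c₄ ^ 3 = ((a : K) + (b : K) * r) * (E.baseChange K).Δ)))
    (hB7 : ∀ (K : Type) [Field K] [NumberField K], NumberField.IsTotallyReal K → Module.finrank ℚ K = 4 → (∃ r : K, r ^ 2 = 5) →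
        ∀ E : WeierstrassCurve (NumberField.RingOfIntegers K), E.Δ ≠ 0 →
          (∃ ρ : Literature.NumberTheory.GaloisRepresentations.FramedGaloisRep K (ZMod 5) 2, (∃ e : (E.baseChange K).geomTorsion ((5 : ℕ) : ℤ) ≃+ (Fin 2 → ZMod 5), ∀ (σ : Field.absoluteGaloisGroup K) (P : (E.baseChange K).geomTorsion ((5 : ℕ) : ℤ)), e (σ • P) = ((ρ σ : GL (Fin 2) (ZMod 5)) : Matrix (Fin 2) (Fin 2) (ZMod 5)) *ᵥ (e P)) ∧ ((∀ σ : Field.absoluteGaloisGroup K, (ρ σ : GL (Fin 2) (ZMod 5)) ∈ Subgroup.closure ({(⟨!![3, 1; 3, 3], !![3, 4; 2, 3], by decide, by decide⟩ : GL (Fin 2) (ZMod 5)), (⟨!![1, 0; 0, 4], !![1, 0; 0, 4], by decide, by decide⟩ : GL (Fin 2) (ZMod 5))} : Set (GL (Fin 2) (ZMod 5)))))) →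
          (∃ ρ : Literature.NumberTheory.GaloisRepresentations.FramedGaloisRep K (ZMod 7) 2, (∃ e : (E.baseChange K).geomTorsion ((7 : ℕ) : ℤ) ≃+ (Fin 2 → ZMod 7), ∀ (σ : Field.absoluteGaloisGroup K) (P : (E.baseChange K).geomTorsion ((7 : ℕ) : ℤ)), e (σ • P) = ((ρ σ : GL (Fin 2) (ZMod 7)) : Matrix (Fin 2) (Fin 2) (ZMod 7)) *ᵥ (e P)) ∧ ((∀ σ : Field.absoluteGaloisGroup K, (((ρ σ : GL (Fin 2) (ZMod 7)) : Matrix (Fin 2) (Fin 2) (ZMod 7)) 1 0 = 0)))) →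
          ((E.baseChange K).HasCM ∨ (∃ r : K, r ^ 2 = 5 ∧ ∃ a b : ℚ, (E.baseChange K).c₄ ^ 3 = ((a : K) + (b : K) * r) * (E.baseChange K).Δ)))
    (hD : ∀ (K : Type) [Field K] [NumberField K], NumberField.IsTotallyReal K → Module.finrank ℚ K = 4 → (∃ r : K, r ^ 2 = 5) →
        ∀ E : WeierstrassCurve (NumberField.RingOfIntegers K), E.Δ ≠ 0 →
          (∃ ρ : Literature.NumberTheory.GaloisRepresentations.FramedGaloisRep K (ZMod 3) 2, (∃ e : (E.baseChange K).geomTorsion ((3 : ℕ) : ℤ) ≃+ (Fin 2 → ZMod 3), ∀ (σ : Field.absoluteGaloisGroup K) (P : (E.baseChange K).geomTorsion ((3 : ℕ) : ℤ)), e (σ • P) = ((ρ σ : GL (Fin 2) (ZMod 3)) : Matrix (Fin 2) (Fin 2) (ZMod 3)) *ᵥ (e P)) ∧ ((∀ σ : Field.absoluteGaloisGroup K, (ρ σ : GL (Fin 2) (ZMod 3)) ∈ Subgroup.closure ({(⟨!![1, 0; 0, 2], !![1, 0; 0, 2], by decide, by decide⟩ : GL (Fin 2) (ZMod 3)), (⟨!![0,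 1; 1, 0], !![0, 1; 1, 0], by decide, by decide⟩ : GL (Fin 2) (ZMod 3))} : Set (GL (Fin 2) (ZMod 3)))))) →
          (∃ ρ : Literature.NumberTheory.GaloisRepresentations.FramedGaloisRep K (ZMod 5) 2, (∃ e : (E.baseChange K).geomTorsion ((5 : ℕ) : ℤ) ≃+ (Fin 2 → ZMod 5), ∀ (σ : Field.absoluteGaloisGroup K) (P : (E.baseChange K).geomTorsion ((5 : ℕ) : ℤ)), e (σ • P) = ((ρ σ : GL (Fin 2) (ZMod 5)) : Matrix (Fin 2) (Fin 2) (ZMod 5)) *ᵥ (e P)) ∧ ((∀ σ : Field.absoluteGaloisGroup K, (ρ σ : GL (Fin 2) (ZMod 5)) ∈ Subgroup.closure ({(⟨!![3, 1; 3, 3], !![3, 4; 2, 3], by decide, by decide⟩ : GL (Fin 2) (ZMod 5)), (⟨!![1, 0; 0, 4], !![1, 0; 0, 4], by decide, by decide⟩ : GL (Fin 2) (ZMod 5))} : Set (GL (Fin 2) (ZMod 5)))))) →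
          ((E.baseChange K).HasCM ∨ (∃ r : K, r ^ 2 = 5 ∧ ∃ a b : ℚ, (E.baseChange K).c₄ ^ 3 = ((a : K) + (b : K) * r) * (E.baseChange K).Δ)))
    (hE : ∀ (K : Type) [Field K] [NumberField K], NumberField.IsTotallyReal K → Module.finrank ℚ K = 4 → (∃ r : K, r ^ 2 = 5) →
        ∀ E : WeierstrassCurve (NumberField.RingOfIntegers K), E.Δ ≠ 0 →
          (∃ ρ : Literature.NumberTheory.GaloisRepresentations.FramedGaloisRep K (ZMod 3) 2, (∃ e : (E.baseChange K).geomTorsion ((3 : ℕ) : ℤ) ≃+ (Fin 2 → ZMod 3), ∀ (σ : Field.absoluteGaloisGroup K) (P : (E.baseChange K).geomTorsion ((3 : ℕ) : ℤ)), e (σ • P) = ((ρ σ : GL (Fin 2) (ZMod 3)) : Matrix (Fin 2) (Fin 2) (ZMod 3)) *ᵥ (e P)) ∧ ((∀ σ : Field.absoluteGaloisGroup K, (((ρ σ : GL (Fin 2) (ZMod 3)) : Matrix (Fin 2) (Fin 2) (ZMod 3)) 1 0 = 0)))) →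
          (∃ ρ : Literature.NumberTheory.GaloisRepresentations.FramedGaloisRep K (ZMod 7) 2, (∃ e : (E.baseChange K).geomTorsion ((7 : ℕ) : ℤ) ≃+ (Fin 2 → ZMod 7), ∀ (σ : Field.absoluteGaloisGroup K) (P : (E.baseChange K).geomTorsion ((7 : ℕ) : ℤ)), e (σ • P) = ((ρ σ : GL (Fin 2) (ZMod 7)) : Matrix (Fin 2) (Fin 2) (ZMod 7)) *ᵥ (e P)) ∧ ((∀ σ : Field.absoluteGaloisGroup K, (ρ σ : GL (Fin 2) (ZMod 7)) ∈ Subgroup.closure ({(⟨!![0, 5; 3, 0], !![0, 5; 3, 0], by decide, by decide⟩ : GL (Fin 2) (ZMod 7)), (⟨!![5, 0; 3, 2], !![3, 0; 6, 4], by decide, by decide⟩ : GL (Fin 2) (ZMod 7))} : Set (GL (Fin 2) (ZMod 7)))))) →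
          ((E.baseChange K).HasCM ∨ (∃ r : K, r ^ 2 = 5 ∧ ∃ a b : ℚ, (E.baseChange K).c₄ ^ 3 = ((a : K) + (b : K) * r) * (E.baseChange K).Δ)))
    (hFLS : FLS2015_theorem1)
    (hBC : isModularEllipticCurve_baseChange_of_isSolvable_of_isAutomorphicOfWeightZero)
    (hM : FLS2015.s3s5_jRelation_of_isTorsionGaloisRep)
    (hE9 : ∀ (K : Type) [Field K] [NumberField K], NumberField.IsTotallyReal K →
      Module.finrank ℚ K = 4 → ∀ r : K, r ^ 2 = 5 → ∀ x₁ x₂ x₃ x₄ : K,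
        (x₁ ≠ 0 ∨ x₂ ≠ 0 ∨ x₃ ≠ 0 ∨ x₄ ≠ 0) → s3s5Quadric x₁ x₂ x₃ x₄ = 0 →
          s3s5Cubic x₁ x₂ x₃ x₄ = 0 →
            s3s5JDen x₃ x₄ = 0 ∨
              ∃ a b : ℚ, s3s5JNum x₂ x₃ x₄ = ((a : K) + (b : K) * r) * s3s5JDen x₃ x₄) :
    RefinedLocusModular :=
  refinedLocusModular_of_certificates hA hB7 (certS3H8_of_facts hM hE9) hD hE hFLS hBC

end Summit.Langlands.Langlands.Theorems.SqrtFiveQuarticCovers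

end
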